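import Literature.AlgebraicGeometry.Resolution.AdicCompletionSemilocal
import Literature.AlgebraicGeometry.Resolution.ExcellentRingsProofs
import Mathlib.RingTheory.AdicCompletion.AsTensorProduct
import Mathlib.RingTheory.Artinian.Ring
import Mathlib.RingTheory.Ideal.GoingUp
import Mathlib.RingTheory.QuasiFinite.Basic
import Mathlib.RingTheory.Finiteness.Ideal
import HarnessLib

/-!
# The completion of a finite algebra: `C ⊗_A Â ≅ Ĉ ≅ Π (C_𝔫)^` (Matsumura 8.7, 8.15; Stacks 07N9)

Topic: `Literature/AlgebraicGeometry/Resolution` (infrastructure for the leaf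
`Stacks07PP_finite_generic` of the decomposition of Matsumura's Thm. 32.3, `FormalFibres.lean`).
Everything here is PROVED:

* `completionTensorEquiv` — **completion commutes with finite base change** (Matsumura
  Thm. 8.7: "`M ⊗_A Â ≅ M̂`" for a finite module `M` over a Noetherian ring `A`, in its ring
  form): for a finite algebra `C` over a Noetherian ring `A` and an ideal `I ⊆ A`, the `C`-algebra
  map `C ⊗_A Â → Ĉ` (`Â = A^_I`, `Ĉ = C^_{IC}`; `c ⊗ x ↦ c·ι(x)`) is an isomorphism — it is
  Mathlib's module isomorphism `AdicCompletion.ofTensorProduct` followed by the change of rings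
  `adicCompletionChangeOfRings` of `ExcellentRingsProofs.lean` (`completionTensor_eq`). This
  generalises `completionBaseChangeEquiv` (surjective `A → C`) of that file.
* `finite_maximalSpectrum_of_finite` — a finite algebra over a local ring has finitely many
  maximal ideals, all containing `𝔪C` (`map_maximalIdeal_le`), and over a Noetherian local ring
  `(⨅ 𝔫)ᵉ ⊆ 𝔪C` for some `e` (`exists_iInf_pow_le_map_maximalIdeal`).
* `Stacks07N9_local` — **Stacks, Tag 07N9, in the local case** (the first reduction of the
  tag's proof: `R` local and `𝔭 = 𝔪`, where the `𝔮ᵢ` are all the maximal ideals of `S`) /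
  Matsumura Thms. 8.7 + 8.15: for a finite algebra `C` over a Noetherian local ring `(A, 𝔪)`:
  `C ⊗_A Â ≃ₐ[C] Π_{𝔫 ∈ Max C} (C_𝔫)^`, the product of the completions of the local rings of
  `C` at its (finitely many) maximal ideals — the composite of `completionTensorEquiv`, the
  cofinality isomorphism `Ĉ_{𝔪C} ≅ Ĉ_{⨅ 𝔫}` (`adicCompletionEquivOfLE`) and
  `Matsumura1987_8_15`; with `Stacks07N9_local_tmul_one` computing it on `c ⊗ 1`.

## Sources

* H. Matsumura, *Commutative Ring Theory*, CUP 1986: Thm. 8.7, p. 60 [PDF 73] ("if `M` is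
  finitely generated then `M ⊗_A Â ≅ M̂`"), Thm. 8.15, p. 62 [PDF 75–76]. [Matsumura1987]
* The Stacks Project, Tag 07N9 (Lemma 10.97.8): "Let `R` be a Noetherian ring. Let `R → S` be
  a finite ring map. Let `𝔭 ⊂ R` be a prime and let `𝔮_1, …, 𝔮_m` be the primes of `S` lying
  over `𝔭`. Then `R_𝔭^∧ ⊗_R S = (S_𝔭)^∧ = S_{𝔮_1}^∧ × … × S_{𝔮_m}^∧` where the `(S_𝔭)^∧` is
  the completion with respect to `𝔭` and the local rings `R_𝔭` and `S_{𝔮ᵢ}` are completed with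
  respect to their maximal ideals"; proof: "We may replace `R` by the localization `R_𝔭` and `S`
  by `S_𝔭 = S ⊗_R R_𝔭`. Hence we may assume that `R` is a local Noetherian ring and that `𝔭 = 𝔪`
  is its maximal ideal." Vendored here in that local case only. [StacksProject]
-/

noncomputable section

namespace Literature.AlgebraicGeometry.Resolution

universe u

open AdicCompletion TensorProduct IsLocalRing

/-! ## Completion commutes with finite base change: `C ⊗_A Â ≅ Ĉ` -/

section BaseChange

variable {A : Type u} [CommRing A] (C : Type u) [CommRing C] [Algebra A C] (I : Ideal A)

/-- The map `ι : Â → Ĉ` induced on `I`-adic completions by the structure map `A → C`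
(`Ĉ` the `IC`-adic completion), as an `A`-algebra homomorphism. [folklore] -/
def completionMapₐ : AdicCompletion I A →ₐ[A] AdicCompletion (I.map (algebraMap A C)) C :=
  { adicCompletionMap I (I.map (algebraMap A C)) (algebraMap A C) le_rfl with
    commutes' := fun a => by
      change adicCompletionMap I (I.map (algebraMap A C)) (algebraMap A C) le_rfl
          (algebraMap A (AdicCompletion I A) a) = algebraMap A _ a
      rw [AdicCompletion.algebraMap_apply, AdicCompletion.algebraMap_apply,
        Algebra.algebraMap_self, RingHom.id_apply, adicCompletionMap_of] }

/-- Unfolding `completionMapₐ`. [folklore] -/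
@[simp]
theorem completionMapₐ_apply (x : AdicCompletion I A) :
    completionMapₐ C I x = adicCompletionMap I (I.map (algebraMap A C)) (algebraMap A C) le_rfl x :=
  rfl

/-- The `C`-algebra map `θ : C ⊗_A Â → Ĉ`, `c ⊗ x ↦ c · ι(x)`. [folklore] -/
def completionTensor : C ⊗[A] AdicCompletion I A →ₐ[C] AdicCompletion (I.map (algebraMap A C)) C :=
  Algebra.TensorProduct.lift (Algebra.ofId C _) (completionMapₐ C I) fun _ _ => Commute.all _ _

/-- `θ (c ⊗ x) = c · ι(x)`. [folklore] -/
@[simp]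
theorem completionTensor_tmul (c : C) (x : AdicCompletion I A) :
    completionTensor C I (c ⊗ₜ x) =
      algebraMap C _ c * adicCompletionMap I (I.map (algebraMap A C)) (algebraMap A C) le_rfl x :=
  Algebra.TensorProduct.lift_tmul _ _ _ c x

/-- Levels of `ι` on the class of a Cauchy sequence `a`: the `n`-th component is the class of
`a n` (mapped to `C`). [folklore] -/
theorem val_adicCompletionMap_mk (n : ℕ) (a : AdicCauchySequence I A) :
    (adicCompletionMap I (I.map (algebraMap A C)) (algebraMap A C) le_rfl
        (AdicCompletion.mk I A a)).val n =
      Ideal.Quotient.mk _ (algebraMap A C (a n)) := by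
  change Ideal.Quotient.factor (le_of_eq (Ideal.mul_top _).symm)
      (adicCompletionMapFamily I _ (algebraMap A C) le_rfl n (AdicCompletion.mk I A a)) = _
  rw [adicCompletionMapFamily_apply, evalₐ_mk, Ideal.quotientMap_mk, Ideal.Quotient.factor_mk]
  rfl

/-- `θ` on elementary tensors, in terms of the `Â`-module structure of `AdicCompletion I C` and
the change of rings `AdicCompletion I C ≅ Ĉ`: `θ (c ⊗ x) = x • [c]`. [folklore] -/
theorem completionTensor_tmul_eq (c : C) (x : AdicCompletion I A) :
    completionTensor C I (c ⊗ₜ x) =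
      adicCompletionChangeOfRings I (I.map (algebraMap A C)) C rfl (x • AdicCompletion.of I C c) := by
  rw [completionTensor_tmul]
  induction x using AdicCompletion.induction_on with
  | h a =>
    ext n
    rw [val_mul, adicCompletionChangeOfRings_val, AdicCompletion.smul_eval, val_adicCompletionMap_mk,
      AdicCompletion.algebraMap_apply, Algebra.algebraMap_self, RingHom.id_apply]
    change _ = quotPowSMulEquiv I _ C rfl n ((a.val n : A) • (AdicCompletion.of I C c).val n)
    simp only [AdicCompletion.of_apply, Submodule.mkQ_apply, ← Submodule.Quotient.mk_smul,
      quotPowSMulEquiv_mk]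
    simp only [Ideal.Quotient.mk_eq_mk]
    rw [← map_mul]
    congr 1
    rw [Algebra.smul_def, mul_comm]

/-- **`θ` is the module isomorphism of Mathlib followed by the change of rings**:
`θ = changeOfRings ∘ AdicCompletion.ofTensorProduct ∘ comm`. [folklore] -/
theorem completionTensor_eq (t : C ⊗[A] AdicCompletion I A) :
    completionTensor C I t =
      adicCompletionChangeOfRings I (I.map (algebraMap A C)) C rfl
        (ofTensorProduct I C (TensorProduct.comm A C (AdicCompletion I A) t)) := by
  induction t using TensorProduct.induction_on with
  | zero => simp
  | tmul c x => rw [completionTensor_tmul_eq, TensorProduct.comm_tmul, ofTensorProduct_tmul]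
  | add t₁ t₂ h₁ h₂ => rw [map_add, h₁, h₂, map_add, map_add, map_add]

/-- `θ : C ⊗_A Â → Ĉ` is bijective for `C` finite over Noetherian `A` (Matsumura Thm. 8.7:
`M ⊗_A Â ≅ M̂` for finite `M`; Mathlib's `ofTensorProduct_bijective_of_finite_of_isNoetherian`).
[cite: Matsumura1987, Thm. 8.7] -/
theorem completionTensor_bijective [IsNoetherianRing A] [Module.Finite A C] :
    Function.Bijective (completionTensor C I) := by
  have h : (completionTensor C I : C ⊗[A] AdicCompletion I A → _) =
      adicCompletionChangeOfRings I (I.map (algebraMap A C)) C rfl ∘ ofTensorProduct I C ∘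
        TensorProduct.comm A C (AdicCompletion I A) :=
    funext (completionTensor_eq C I)
  rw [h]
  exact (LinearEquiv.bijective _).comp
    ((ofTensorProduct_bijective_of_finite_of_isNoetherian I C).comp (LinearEquiv.bijective _))

/-- **Completion commutes with finite base change** (Matsumura Thm. 8.7 in ring form; Stacks
07N9, first equality "`S^∧ = S ⊗_R R^∧`"): `C ⊗_A Â ≃ₐ[C] Ĉ` for a finite algebra `C` over a
Noetherian ring `A` and any ideal `I` of `A` (`Ĉ` = the `IC`-adic completion).
[cite: Matsumura1987, Thm. 8.7] -/
def completionTensorEquiv [IsNoetherianRing A] [Module.Finite A C] :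
    C ⊗[A] AdicCompletion I A ≃ₐ[C] AdicCompletion (I.map (algebraMap A C)) C :=
  AlgEquiv.ofBijective (completionTensor C I) (completionTensor_bijective C I)

/-- `completionTensorEquiv (c ⊗ x) = c · ι(x)`. [folklore] -/
@[simp]
theorem completionTensorEquiv_tmul [IsNoetherianRing A] [Module.Finite A C] (c : C)
    (x : AdicCompletion I A) :
    completionTensorEquiv C I (c ⊗ₜ x) =
      algebraMap C _ c * adicCompletionMap I (I.map (algebraMap A C)) (algebraMap A C) le_rfl x :=
  completionTensor_tmul C I c x

end BaseChange


/-! ## Finite algebras over a Noetherian local ring are semilocal -/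

section FiniteOverLocal

variable (A C : Type u) [CommRing A] [CommRing C] [Algebra A C] [IsLocalRing A]
  [Module.Finite A C]

omit [Module.Finite A C] in
/-- A maximal ideal of an integral (e.g. finite) algebra `C` over a local ring `(A, 𝔪)` lies
over `𝔪`. (The same statement, in `Ideal.under` form, is
`Literature.RingTheory.OrderOfVanishing.under_eq_maximalIdeal` of `NormOrd.lean`; duplicated
here pending consolidation, to avoid that file's unrelated imports.) [folklore] -/
theorem under_eq_maximalIdeal_of_isMaximal [Algebra.IsIntegral A C] (n : Ideal C) [n.IsMaximal] :
    n.comap (algebraMap A C) = maximalIdeal A :=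
  IsLocalRing.eq_maximalIdeal (Ideal.isMaximal_comap_of_isIntegral_of_isMaximal n)

/-- Every maximal ideal of `C` contains `𝔪C`. [folklore] -/
theorem map_maximalIdeal_le (n : Ideal C) [n.IsMaximal] :
    (maximalIdeal A).map (algebraMap A C) ≤ n :=
  Ideal.map_le_iff_le_comap.mpr (under_eq_maximalIdeal_of_isMaximal A C n).ge

/-- `𝔪C ⊆ ⨅ 𝔫`, the intersection of the maximal ideals of `C`. [folklore] -/
theorem map_maximalIdeal_le_iInf :
    (maximalIdeal A).map (algebraMap A C) ≤ ⨅ n : MaximalSpectrum C, n.asIdeal :=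
  le_iInf fun n => @map_maximalIdeal_le A C _ _ _ _ _ n.asIdeal n.isMaximal

/-- A prime of `C` containing `𝔪C` is maximal (it lies over the maximal ideal `𝔪`, and `C` is
integral over `A`). [folklore] -/
theorem isMaximal_of_isPrime_of_map_maximalIdeal_le (P : Ideal C) [P.IsPrime]
    (hP : (maximalIdeal A).map (algebraMap A C) ≤ P) : P.IsMaximal := by
  have h1 : maximalIdeal A ≤ P.comap (algebraMap A C) := Ideal.map_le_iff_le_comap.mp hP
  have h2 : P.comap (algebraMap A C) = maximalIdeal A :=
    le_antisymm (IsLocalRing.le_maximalIdeal (Ideal.IsPrime.ne_top inferInstance)) h1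
  haveI : (P.comap (algebraMap A C)).IsMaximal := h2 ▸ inferInstance
  exact Ideal.isMaximal_of_isIntegral_of_isMaximal_comap (R := A) P inferInstance

/-- `⨅ 𝔫 ⊆ √(𝔪C)`: every prime containing `𝔪C` is one of the `𝔫`. [folklore] -/
theorem iInf_le_radical_map_maximalIdeal :
    (⨅ n : MaximalSpectrum C, n.asIdeal) ≤ ((maximalIdeal A).map (algebraMap A C)).radical := by
  rw [Ideal.radical_eq_sInf]
  refine le_sInf fun P hP => ?_
  haveI : P.IsPrime := hP.2
  exact iInf_le_of_le ⟨P, isMaximal_of_isPrime_of_map_maximalIdeal_le A C P hP.1⟩ le_rfl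

/-- `(⨅ 𝔫)ᵉ ⊆ 𝔪C` for some `e`, when `A` is Noetherian (so that `C` is). [folklore] -/
theorem exists_iInf_pow_le_map_maximalIdeal [IsNoetherianRing A] :
    ∃ e : ℕ, (⨅ n : MaximalSpectrum C, n.asIdeal) ^ e ≤ (maximalIdeal A).map (algebraMap A C) := by
  haveI : IsNoetherianRing C := isNoetherian_of_tower A inferInstance
  exact Ideal.exists_pow_le_of_le_radical_of_fg (iInf_le_radical_map_maximalIdeal A C)
    (IsNoetherian.noetherian _)

include A in
/-- **A finite algebra over a local ring has finitely many maximal ideals** (they are primes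
over `𝔪`, and there are finitely many of those, Mathlib's `Algebra.QuasiFinite.finite_primesOver`).
(Identical to `Literature.RingTheory.OrderOfVanishing.finite_maximalSpectrum` of `NormOrd.lean`;
duplicated here pending consolidation, to avoid that file's unrelated imports.) [folklore] -/
theorem finite_maximalSpectrum_of_finite : Finite (MaximalSpectrum C) := by
  have hfin : ((maximalIdeal A).primesOver C).Finite := Algebra.QuasiFinite.finite_primesOver _
  haveI := hfin.to_subtype
  refine Finite.of_injective
    (fun n : MaximalSpectrum C =>
      (⟨n.asIdeal, ⟨@Ideal.IsMaximal.isPrime _ _ _ n.isMaximal,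
        ⟨(@under_eq_maximalIdeal_of_isMaximal A C _ _ _ _ _ n.asIdeal n.isMaximal).symm⟩⟩⟩ :
        (maximalIdeal A).primesOver C))
    fun n n' h => MaximalSpectrum.ext (congrArg Subtype.val h)

end FiniteOverLocal

/-! ## Stacks 07N9: `C ⊗_A Â ≅ Π (C_𝔫)^` -/

section Stacks07N9

variable (A C : Type u) [CommRing A] [CommRing C] [Algebra A C] [IsLocalRing A]
  [IsNoetherianRing A] [Module.Finite A C]

/-- The ring isomorphism `Ĉ_{𝔪C} ≃ Π_𝔫 (C_𝔫)^` (product over the finitely many maximal ideals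
of `C`, `finite_maximalSpectrum_of_finite`): cofinality `𝔪C ~ ⨅ 𝔫` followed by Matsumura
Thm. 8.15. [cite: Matsumura1987, Thm. 8.15] -/
def completionMapMaximalIdealPiEquiv :
    AdicCompletion ((maximalIdeal A).map (algebraMap A C)) C ≃+*
      ∀ n : MaximalSpectrum C,
        AdicCompletion (maximalIdeal (Localization.AtPrime n.asIdeal))
          (Localization.AtPrime n.asIdeal) :=
  letI : Fintype (MaximalSpectrum C) := @Fintype.ofFinite _ (finite_maximalSpectrum_of_finite A C)
  (adicCompletionEquivOfLE ((maximalIdeal A).map (algebraMap A C))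
      (⨅ n : MaximalSpectrum C, n.asIdeal)
      (Classical.choose_spec (exists_iInf_pow_le_map_maximalIdeal A C))
      (map_maximalIdeal_le_iInf A C)).trans
    (Matsumura1987_8_15 C)

/-- `completionMapMaximalIdealPiEquiv` extends the maps `C → C_𝔫`. [folklore] -/
@[simp]
theorem completionMapMaximalIdealPiEquiv_of (c : C) (n : MaximalSpectrum C) :
    completionMapMaximalIdealPiEquiv A C (of _ C c) n =
      of _ (Localization.AtPrime n.asIdeal) (algebraMap C (Localization.AtPrime n.asIdeal) c) := by
  letI : Fintype (MaximalSpectrum C) := @Fintype.ofFinite _ (finite_maximalSpectrum_of_finite A C)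
  rw [completionMapMaximalIdealPiEquiv, RingEquiv.trans_apply, adicCompletionEquivOfLE_of]
  exact Matsumura1987_8_15_of C c n

/-- **Stacks, Tag 07N9 (Lemma 10.97.8), local case.** The tag as printed: "Let `R` be a
Noetherian ring. Let `R → S` be a finite ring map. Let `𝔭 ⊂ R` be a prime and let `𝔮_1, …, 𝔮_m`
be the primes of `S` lying over `𝔭`. Then `R_𝔭^∧ ⊗_R S = (S_𝔭)^∧ = S_{𝔮_1}^∧ × … × S_{𝔮_m}^∧`
where the `(S_𝔭)^∧` is the completion with respect to `𝔭` and the local rings `R_𝔭` and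
`S_{𝔮ᵢ}` are completed with respect to their maximal ideals." VENDORED IN THE LOCAL CASE `R`
local Noetherian and `𝔭 = 𝔪` its maximal ideal — the first reduction of the tag's proof ("We
may replace `R` by the localization `R_𝔭` and `S` by `S_𝔭 = S ⊗_R R_𝔭`. Hence we may assume
that `R` is a local Noetherian ring and that `𝔭 = 𝔪` is its maximal ideal"), in which the
`𝔮ᵢ` are all the (finitely many, `finite_maximalSpectrum_of_finite`) maximal ideals of `S`:
for a finite algebra `C` over a Noetherian local ring `(A, 𝔪)`,
`C ⊗_A Â ≃ₐ[C] Π_{𝔫 ∈ Max C} (C_𝔫)^` (Matsumura Thms. 8.7 and 8.15).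
[cite: StacksProject, Tag 07N9] -/
def Stacks07N9_local :
    C ⊗[A] AdicCompletion (maximalIdeal A) A ≃ₐ[C]
      ∀ n : MaximalSpectrum C,
        AdicCompletion (maximalIdeal (Localization.AtPrime n.asIdeal))
          (Localization.AtPrime n.asIdeal) :=
  (completionTensorEquiv C (maximalIdeal A)).trans
    (AlgEquiv.ofRingEquiv (f := completionMapMaximalIdealPiEquiv A C) fun c => by
      funext n
      rw [AdicCompletion.algebraMap_apply, Algebra.algebraMap_self, RingHom.id_apply,
        completionMapMaximalIdealPiEquiv_of, Pi.algebraMap_apply, AdicCompletion.algebraMap_apply])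

/-- `Stacks07N9_local` on `c ⊗ 1`: the tuple of the images of `c` in the `(C_𝔫)^`. [folklore] -/
@[simp]
theorem Stacks07N9_local_tmul_one (c : C) (n : MaximalSpectrum C) :
    Stacks07N9_local A C (c ⊗ₜ 1) n =
      of _ (Localization.AtPrime n.asIdeal) (algebraMap C (Localization.AtPrime n.asIdeal) c) := by
  rw [Stacks07N9_local, AlgEquiv.trans_apply, completionTensorEquiv_tmul, map_one, mul_one,
    AdicCompletion.algebraMap_apply, Algebra.algebraMap_self, RingHom.id_apply]
  exact completionMapMaximalIdealPiEquiv_of A C c n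

end Stacks07N9

end Literature.AlgebraicGeometry.Resolution

end
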